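import Summits.BirchSwinnertonDyer.Rank1Residual.Additive.TameBranchTwoValueRankOne
import Summits.BirchSwinnertonDyer.Rank1Residual.Additive.TameBranchOneValueCharacterFree
import HarnessLib

/-!
# PRINT + TWO NUMBERS, character-free, every Kodaira type: the two-value joins with the Teichmüller
# power supplied by the tree, and the rank-zero sign read from one value (cell `b2b-bsdres`,
# sub-cell additive-p2 = X3♯(G-ord)/X4♯(G-ord), gen 28; part 4/4)

HONEST FRAMING (cell `b2b-bsdres`, run/shared/lean/b2b/bsd-rank1-residual/, verbatim in every
file): the goal of the cell is to DELETE the COMBINATION-SHAPED residual classes of the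
Birch–Swinnerton-Dyer formula for ALL analytic-rank `≤ 1` elliptic curves over `ℚ` — "full BSD
formula for every rank `≤ 1` curve in class `C`" assembled STRICTLY from published theorems — so
that the rank-`≤ 1` remainder becomes exactly the CONSTRUCTION-SHAPED classes, which are TYPED
(missing-input `Prop`s), NOT attempted. This is not "finishing BSD". Sub-cell additive-p2: the
classes X3♯(G-ord) / X4♯(G-ord) are CONSTRUCTION-SHAPED and stay so; labels / RESIDUAL-MAP marks
UNCHANGED; nothing is booked. Theorems only; the named facts enter as hypothesis binders
(`Delbourgo1998.thm1_exists_bounded_evenMeasure` A282, `Delbourgo2002.mainTheorem` A175,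
`Delbourgo2002.thmC_charIdeal_dvd_tameBranch` A227, `Delbourgo2002.mainTheorem_potMult`, GZK).
No definition, no `sorry`.

## What

Parts 1–3 (`TameBranchTwoValueLaw.lean`, `TameBranchTwoValueCertificateJoin.lean`,
`TameBranchTwoValueRankOne.lean`) take a character `χ = ω^u` of `ℤ/p` of order `e` as a per-pair input
(a finite check). On the (G)-cell `e ∣ p − 1`, so the tree supplies it (gen 27
`exists_small_teichmullerPow_of_typeGOrd`: cc-typer-1's `CensusX43.exists_isTeichmullerPow` +
cc-typer-2's `orderOf_eq_of_isTeichmullerPow`). Hence the CHARACTER-FREE forms: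

* `charLamLeAt_of_thm1_of_thmC_of_two_norm_ratTwistedSymbolSum'` — `p ≥ 5`, non-CM, ADDITIVE,
  (G)-ordinary, `e ∈ {3,4,6}`, tower bound `p^c`, TWO even primitive `p`-power-order characters at
  consecutive conductors whose twisted symbol sums lie on ONE line `t ∈ {1, e−1}` with a common `k`,
  `e·k < 2φₙ` ⟹ `CharLamLeAt W p k`;
* `exists_schneider_rankOne_of_thm1_of_two_norm_ratTwistedSymbolSum'`,
  **`ClassX4Gord.exists_schneider_rankOne_of_thm1_of_two_norm_ratTwistedSymbolSum'`** — X4♯(G-ord),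
  `e ∈ {3,4,6}`, `ord_{s=1}L = 1`, `p ≥ 5`, non-CM, EVERY Kodaira type: PRINT (Delbourgo 1998 Thm 1;
  2002 (A)(B)(C); GZK; Drinfeld–Manin) + **TWO NUMBERS** `‖S(κ)‖^{e·φₙ} = p^{−(e+t·φₙ)}`,
  `‖S(κ')‖^{e·φₙ₊₁} = p^{−(e+t·φₙ₊₁)}` ⟹ Schneider for every (B)-datum — gen 27's one-number headline
  held on the UNSTARRED rows only; `ClassX3Gord.…'` (+ bound `p^c`),
  `ClassX4Gord.padicVal_identity_rankOne_…'`;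
* RANK ZERO — **the sign READ from one value**: gen 27's dichotomy (plus-symbol bound attained at `0`
  ⟹ ALL wild values are `(p^c)^e·p⁻¹` or ALL are `(p^c)^e·p^{−(e−1)}`) left "which one" open; here ONE
  wild `κ` with the STARRED constant gives a witness of `(ι∘χ⁻¹, ã₀)` for `χ = ω^u` (Delbourgo's
  `ε = ω^{(e−1)u}`), the UNSTARRED constant a witness of `(ι∘χ, ã₀)` (E-GAUSSCERT-R0: 111 resp. 57 rows).

Not claimed: `μ`; the LOWER half; which Teichmüller power is bounded on which Kodaira type (the
dictionary `t = e−1 ⟺ starred` is EVIDENCE); any booking.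

References: Delbourgo 1998 Thm. 1 [Delbourgo1998]; Delbourgo 2002 Thm. (A)(B)(C) [Delbourgo2002]; Lang
Ch. 1 §2 Thm. 2.1 [Lang1990]; MTT 1986 §I.8, §I.13–I.14 [MazurTateTeitelbaum1986Invent]; [Manin1972]. -/

set_option autoImplicit false

noncomputable section

open scoped Classical MatrixGroups ModularForm NumberField

open CongruenceSubgroup IsDedekindDomain WeierstrassCurve NumberField
  Literature.NumberTheory.EllipticCurves
  Literature.NumberTheory.EllipticCurves.ModularForms
  Literature.NumberTheory.EllipticCurves.Rank1Residual
  Literature.NumberTheory.EllipticCurves.Rank1Residual.Typed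
  Literature.NumberTheory.EllipticCurves.Delbourgo2002
  Summit.BirchSwinnertonDyer.Rank1Residual.X1.MuLambda
  Summit.BirchSwinnertonDyer.Rank1Residual.X11a.LambdaNorm

namespace Summit.BirchSwinnertonDyer.Rank1Residual.Additive

namespace TwistPartner

open TameBranchOneValue TameBranchTwoValue

section CharacterFree

variable {W : WeierstrassCurve ℚ} [W.IsElliptic] [W.IsGloballyMinimal] {p : ℕ} [hp : Fact p.Prime]
  {N : ℕ} [NeZero N] {f : CuspForm (Gamma0 N) 2}

/-- **`CharLamLeAt W p k` FROM PRINT AND TWO VALUES — CHARACTER-FREE, TYPE-FREE.** `p ≥ 5`, `E = W`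
non-CM, ADDITIVE, (G)-ordinary, `e = semistabilityIndex W p ∈ {3,4,6}`, newform `f`, tower bound
`‖[a/p^m]⁺_f‖_p ≤ p^c`, and TWO even primitive `p`-power-order characters `κ`, `κ'` of conductors
`p^{n+1+e₀}`, `p^{n+2+e₀}` with **`‖S(κ)‖^{e·φₙ} = (p^c)^{e·φₙ}·p^{−(e·k+t·φₙ)}`**,
**`‖S(κ')‖^{e·φₙ₊₁} = (p^c)^{e·φₙ₊₁}·p^{−(e·k+t·φₙ₊₁)}`** for one `t ∈ {1, e−1}`, `e·k < 2φₙ` ⟹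
`CharLamLeAt W p k`. Nothing booked. [cite: Delbourgo1998, Theorem 1 (p. 131)]
[cite: Delbourgo2002, Theorem (A), (C) (p. 40)] [cite: Lang1990, Ch. 1 §2 Thm. 2.1]
[cite: MazurTateTeitelbaum1986Invent, §I.8, §I.13–I.14] -/
theorem charLamLeAt_of_thm1_of_thmC_of_two_norm_ratTwistedSymbolSum'
    (hD : Delbourgo1998.thm1_exists_bounded_evenMeasure)
    (hC : Delbourgo2002.thmC_charIdeal_dvd_tameBranch) (hDel : Delbourgo2002.mainTheorem)
    (hDelM : Delbourgo2002.mainTheorem_potMult) (h5 : 5 ≤ p) (hcm : ¬ W.HasCM) (hadd : Addv W p)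
    (hGord : TypeGOrd W p) (he : semistabilityIndex W p ∈ ({3, 4, 6} : Finset ℕ))
    (hf : IsNewformOf W f) {c : ℕ}
    (hc : ∀ (m : ℕ) (a : ℤ), ‖((ratPlusSymbol f ((a : ℚ) / (p : ℚ) ^ m) : ℚ) : ℚ_[p])‖ ≤ (p : ℝ) ^ c)
    {n : ℕ} {κ : DirichletCharacter ℂ_[p] (p ^ (n + 1 + cyclotomicExponent p))} (hκ : κ.IsPrimitive)
    (heven : κ.Even) (hord : ∃ j : ℕ, orderOf κ = p ^ j)
    {κ' : DirichletCharacter ℂ_[p] (p ^ (n + 1 + 1 + cyclotomicExponent p))} (hκ' : κ'.IsPrimitive)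
    (heven' : κ'.Even) (hord' : ∃ j : ℕ, orderOf κ' = p ^ j) {k t : ℕ}
    (ht : t = 1 ∨ t = semistabilityIndex W p - 1)
    (hk2 : semistabilityIndex W p * k < 2 * Nat.totient (p ^ (n + 1)))
    (hval : ‖ratTwistedSymbolSum f κ‖ ^ (semistabilityIndex W p * Nat.totient (p ^ (n + 1))) =
      ((p : ℝ) ^ c) ^ (semistabilityIndex W p * Nat.totient (p ^ (n + 1))) *
        ((p : ℝ)⁻¹) ^ (semistabilityIndex W p * k + t * Nat.totient (p ^ (n + 1))))
    (hval' : ‖ratTwistedSymbolSum f κ'‖ ^ (semistabilityIndex W p * Nat.totient (p ^ (n + 1 + 1))) =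
      ((p : ℝ) ^ c) ^ (semistabilityIndex W p * Nat.totient (p ^ (n + 1 + 1))) *
        ((p : ℝ)⁻¹) ^ (semistabilityIndex W p * k + t * Nat.totient (p ^ (n + 1 + 1)))) :
    CharLamLeAt W p k := by
  obtain ⟨u, χ, hu, hχe, hteich⟩ := exists_small_teichmullerPow_of_typeGOrd (W := W) h5 hGord
  exact charLamLeAt_of_thm1_of_thmC_of_two_norm_ratTwistedSymbolSum hD hC hDel hDelM h5 hcm hadd hGord
    he hf hχe hu hteich hc hκ heven hord hκ' heven' hord' ht hk2 hval hval'

/-- **Schneider at `ord_{s=1}L(E,s) = 1` FROM PRINT AND TWO NUMBERS — CHARACTER-FREE, every Kodaira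
type** (general locus: `p ≥ 5`, ADDITIVE, (G)-ordinary, non-CM, `e ∈ {3,4,6}`, plus-symbol bound `p^c`):
TWO values on one line `t ∈ {1, e−1}` with `k = 1` ⟹ Schneider's conjecture for every (B)-datum of
Delbourgo 2002, and one exists. [cite: Delbourgo1998, Theorem 1 (p. 131)]
[cite: Delbourgo2002, Theorem (A), (B), (C) (p. 40)] [cite: Lang1990, Ch. 1 §2 Thm. 2.1] -/
theorem exists_schneider_rankOne_of_thm1_of_two_norm_ratTwistedSymbolSum'
    (hD : Delbourgo1998.thm1_exists_bounded_evenMeasure)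
    (hC : Delbourgo2002.thmC_charIdeal_dvd_tameBranch) (hDel : Delbourgo2002.mainTheorem)
    (hDelM : Delbourgo2002.mainTheorem_potMult) (hGZK : rank_eq_analyticRank_of_analyticRank_le_one)
    (h5 : 5 ≤ p) (hcm : ¬ W.HasCM) (hadd : Addv W p) (hGord : TypeGOrd W p)
    (he : semistabilityIndex W p ∈ ({3, 4, 6} : Finset ℕ)) (hr : W.analyticRank = 1)
    (hf : IsNewformOf W f) {c : ℕ}
    (hc : ∀ (m : ℕ) (a : ℤ), ‖((ratPlusSymbol f ((a : ℚ) / (p : ℚ) ^ m) : ℚ) : ℚ_[p])‖ ≤ (p : ℝ) ^ c)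
    {n : ℕ} {κ : DirichletCharacter ℂ_[p] (p ^ (n + 1 + cyclotomicExponent p))} (hκ : κ.IsPrimitive)
    (heven : κ.Even) (hord : ∃ j : ℕ, orderOf κ = p ^ j)
    {κ' : DirichletCharacter ℂ_[p] (p ^ (n + 1 + 1 + cyclotomicExponent p))} (hκ' : κ'.IsPrimitive)
    (heven' : κ'.Even) (hord' : ∃ j : ℕ, orderOf κ' = p ^ j) {t : ℕ}
    (ht : t = 1 ∨ t = semistabilityIndex W p - 1)
    (hval : ‖ratTwistedSymbolSum f κ‖ ^ (semistabilityIndex W p * Nat.totient (p ^ (n + 1))) =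
      ((p : ℝ) ^ c) ^ (semistabilityIndex W p * Nat.totient (p ^ (n + 1))) *
        ((p : ℝ)⁻¹) ^ (semistabilityIndex W p + t * Nat.totient (p ^ (n + 1))))
    (hval' : ‖ratTwistedSymbolSum f κ'‖ ^ (semistabilityIndex W p * Nat.totient (p ^ (n + 1 + 1))) =
      ((p : ℝ) ^ c) ^ (semistabilityIndex W p * Nat.totient (p ^ (n + 1 + 1))) *
        ((p : ℝ)⁻¹) ^ (semistabilityIndex W p + t * Nat.totient (p ^ (n + 1 + 1)))) :
    (∀ Dh : PAdicHeightData W p, LeadingTermClauses W p Dh → SchneiderConjecture Dh) ∧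
      ∃ Dh : PAdicHeightData W p, LeadingTermClauses W p Dh ∧ SchneiderConjecture Dh := by
  obtain ⟨u, χ, hu, hχe, hteich⟩ := exists_small_teichmullerPow_of_typeGOrd (W := W) h5 hGord
  exact exists_schneider_rankOne_of_thm1_of_two_norm_ratTwistedSymbolSum hD hC hDel hDelM hGZK h5 hcm
    hadd hGord he hr hf hχe hu hteich hc hκ heven hord hκ' heven' hord' ht hval hval'

/-- **X4♯(G-ord), defect 3, 4, 6, `ord_{s=1}L(E,s) = 1`, `p ≥ 5`, non-CM, EVERY KODAIRA TYPE — SCHNEIDER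
FROM PRINTED FACTS AND TWO NUMBERS, character-free.** Printed: Delbourgo 1998 Thm. 1; Delbourgo 2002
(A), (B), (C); GZK; Drinfeld–Manin integrality on X4. Per pair: TWO even primitive `p`-power-order
characters `κ`, `κ'` of conductors `p^{n+1+e₀}`, `p^{n+2+e₀}` with **`‖Σ_b κ(b)[b/p^{n+1+e₀}]⁺_f‖_p^{e·φₙ} =
p^{−(e + t·φₙ)}`** and **`‖Σ_b κ'(b)[b/p^{n+2+e₀}]⁺_f‖_p^{e·φₙ₊₁} = p^{−(e + t·φₙ₊₁)}`** for ONE `t ∈ {1, e−1}`,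
`e = semistabilityIndex W p` (`ord_p S = 1/φ + t/e` at both conductors). Then Schneider's conjecture
holds for every (B)-datum. NO (G)-field, NO unit root, NO character, NO forced partner, NO sign
certificate, NO Riemann sum, NO Kodaira type. EVIDENCE (not an input): the starred line (`t = e−1`) at
`k = 1` is met on the four STARRED unit rows of the Gord_e346 window (X3), the `k = 3` starred pair on
the X4 row 11760bb1@7 — HOME/b2b-bsdres-additive-p2/gen28/TWO-VALUE-READING.md; the unstarred line
on the unstarred unit rows (gen 27). Nothing booked; X4♯(G-ord) stays CONSTRUCTION-SHAPED.
[cite: Delbourgo1998, Theorem 1 (p. 131)] [cite: Delbourgo2002, Theorem (A), (B), (C) (p. 40)]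
[cite: Manin1972, Cor. 3.6] [cite: Lang1990, Ch. 1 §2 Thm. 2.1] -/
theorem ClassX4Gord.exists_schneider_rankOne_of_thm1_of_two_norm_ratTwistedSymbolSum'
    (hD : Delbourgo1998.thm1_exists_bounded_evenMeasure)
    (hC : Delbourgo2002.thmC_charIdeal_dvd_tameBranch) (hDel : Delbourgo2002.mainTheorem)
    (hDelM : Delbourgo2002.mainTheorem_potMult) (hGZK : rank_eq_analyticRank_of_analyticRank_le_one)
    (hX : ClassX4Gord W p) (h5 : 5 ≤ p) (hcm : ¬ W.HasCM)
    (he : semistabilityIndex W p ∈ ({3, 4, 6} : Finset ℕ)) (hr : W.analyticRank = 1)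
    (hf : IsNewformOf W f)
    {n : ℕ} {κ : DirichletCharacter ℂ_[p] (p ^ (n + 1 + cyclotomicExponent p))} (hκ : κ.IsPrimitive)
    (heven : κ.Even) (hord : ∃ j : ℕ, orderOf κ = p ^ j)
    {κ' : DirichletCharacter ℂ_[p] (p ^ (n + 1 + 1 + cyclotomicExponent p))} (hκ' : κ'.IsPrimitive)
    (heven' : κ'.Even) (hord' : ∃ j : ℕ, orderOf κ' = p ^ j) {t : ℕ}
    (ht : t = 1 ∨ t = semistabilityIndex W p - 1)
    (hval : ‖ratTwistedSymbolSum f κ‖ ^ (semistabilityIndex W p * Nat.totient (p ^ (n + 1))) =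
      ((p : ℝ)⁻¹) ^ (semistabilityIndex W p + t * Nat.totient (p ^ (n + 1))))
    (hval' : ‖ratTwistedSymbolSum f κ'‖ ^ (semistabilityIndex W p * Nat.totient (p ^ (n + 1 + 1))) =
      ((p : ℝ)⁻¹) ^ (semistabilityIndex W p + t * Nat.totient (p ^ (n + 1 + 1)))) :
    (∀ Dh : PAdicHeightData W p, LeadingTermClauses W p Dh → SchneiderConjecture Dh) ∧
      ∃ Dh : PAdicHeightData W p, LeadingTermClauses W p Dh ∧ SchneiderConjecture Dh := by
  obtain ⟨u, χ, hu, hχe, hteich⟩ := exists_small_teichmullerPow_of_typeGOrd (W := W) h5 hX.typeGOrd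
  exact ClassX4Gord.exists_schneider_rankOne_of_thm1_of_two_norm_ratTwistedSymbolSum hD hC hDel hDelM hGZK
    hX h5 hcm he hr hf hχe hu hteich hκ heven hord hκ' heven' hord' ht hval hval'

/-- **X3♯(G-ord), defect 3, 4, 6, `ord_{s=1}L(E,s) = 1`, `p ≥ 5`, non-CM, every Kodaira type —
character-free twin with the tower bound `p^c` of the plus symbols**: printed facts + `hc` + TWO values
on one line `t ∈ {1, e−1}` with `k = 1` ⟹ Schneider for Delbourgo's datum. EVIDENCE (not an input): met
with `c = 0`, `t = e−1` on the starred window rows 10725e1, 11550n1, 11825i1 @5 and 19110bm1@7. Nothing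
booked; X3♯(G-ord) CONSTRUCTION-SHAPED. [cite: Delbourgo1998, Theorem 1 (p. 131)]
[cite: Delbourgo2002, Theorem (A), (B), (C) (p. 40)] [cite: Lang1990, Ch. 1 §2 Thm. 2.1] -/
theorem ClassX3Gord.exists_schneider_rankOne_of_thm1_of_two_norm_ratTwistedSymbolSum'
    (hD : Delbourgo1998.thm1_exists_bounded_evenMeasure)
    (hC : Delbourgo2002.thmC_charIdeal_dvd_tameBranch) (hDel : Delbourgo2002.mainTheorem)
    (hDelM : Delbourgo2002.mainTheorem_potMult) (hGZK : rank_eq_analyticRank_of_analyticRank_le_one)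
    (hX : ClassX3Gord W p) (h5 : 5 ≤ p) (hcm : ¬ W.HasCM)
    (he : semistabilityIndex W p ∈ ({3, 4, 6} : Finset ℕ)) (hr : W.analyticRank = 1)
    (hf : IsNewformOf W f) {c : ℕ}
    (hc : ∀ (m : ℕ) (a : ℤ), ‖((ratPlusSymbol f ((a : ℚ) / (p : ℚ) ^ m) : ℚ) : ℚ_[p])‖ ≤ (p : ℝ) ^ c)
    {n : ℕ} {κ : DirichletCharacter ℂ_[p] (p ^ (n + 1 + cyclotomicExponent p))} (hκ : κ.IsPrimitive)
    (heven : κ.Even) (hord : ∃ j : ℕ, orderOf κ = p ^ j)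
    {κ' : DirichletCharacter ℂ_[p] (p ^ (n + 1 + 1 + cyclotomicExponent p))} (hκ' : κ'.IsPrimitive)
    (heven' : κ'.Even) (hord' : ∃ j : ℕ, orderOf κ' = p ^ j) {t : ℕ}
    (ht : t = 1 ∨ t = semistabilityIndex W p - 1)
    (hval : ‖ratTwistedSymbolSum f κ‖ ^ (semistabilityIndex W p * Nat.totient (p ^ (n + 1))) =
      ((p : ℝ) ^ c) ^ (semistabilityIndex W p * Nat.totient (p ^ (n + 1))) *
        ((p : ℝ)⁻¹) ^ (semistabilityIndex W p + t * Nat.totient (p ^ (n + 1))))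
    (hval' : ‖ratTwistedSymbolSum f κ'‖ ^ (semistabilityIndex W p * Nat.totient (p ^ (n + 1 + 1))) =
      ((p : ℝ) ^ c) ^ (semistabilityIndex W p * Nat.totient (p ^ (n + 1 + 1))) *
        ((p : ℝ)⁻¹) ^ (semistabilityIndex W p + t * Nat.totient (p ^ (n + 1 + 1)))) :
    (∀ Dh : PAdicHeightData W p, LeadingTermClauses W p Dh → SchneiderConjecture Dh) ∧
      ∃ Dh : PAdicHeightData W p, LeadingTermClauses W p Dh ∧ SchneiderConjecture Dh := by
  obtain ⟨u, χ, hu, hχe, hteich⟩ := exists_small_teichmullerPow_of_typeGOrd (W := W) h5 hX.typeGOrd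
  exact ClassX3Gord.exists_schneider_rankOne_of_thm1_of_two_norm_ratTwistedSymbolSum hD hC hDel hDelM hGZK
    hX h5 hcm he hr hf hχe hu hteich hc hκ heven hord hκ' heven' hord' ht hval hval'

/-- **X4♯(G-ord), defect 3, 4, 6, `rank E(ℚ) = 1`, `p ≥ 5`, non-CM, every Kodaira type — THE VALUATION
IDENTITY FROM PRINTED FACTS AND TWO NUMBERS, character-free**: for every (B)-datum `Dh` and every
Pontryagin-dual datum with `char = (fE)`: Schneider, `#Ш[p^∞] < ∞`, `λ(fE) = 1`, and
`ord Ш[p^∞] + ord Reg_p(Dh) + ord ∏c + ord ℓ = μ(fE) + 1 + 2 ord #E(ℚ)_tors`, `ℓ ∣ p²`, `ℓ = 1` off the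
anomalous rows. Nothing booked. [cite: Delbourgo1998, Theorem 1 (p. 131)]
[cite: Delbourgo2002, Theorem (A), (B), (C) (p. 40)] [cite: Manin1972, Cor. 3.6] [cite: Lang1990, Ch. 1 §2 Thm. 2.1] -/
theorem ClassX4Gord.padicVal_identity_rankOne_of_thm1_of_two_norm_ratTwistedSymbolSum'
    (hD : Delbourgo1998.thm1_exists_bounded_evenMeasure)
    (hC : Delbourgo2002.thmC_charIdeal_dvd_tameBranch) (hDel : Delbourgo2002.mainTheorem)
    (hDelM : Delbourgo2002.mainTheorem_potMult) (hX : ClassX4Gord W p) (h5 : 5 ≤ p) (hcm : ¬ W.HasCM)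
    (he : semistabilityIndex W p ∈ ({3, 4, 6} : Finset ℕ)) (hrk : W.mordellWeilRank = 1)
    (hf : IsNewformOf W f)
    {n : ℕ} {κ : DirichletCharacter ℂ_[p] (p ^ (n + 1 + cyclotomicExponent p))} (hκ : κ.IsPrimitive)
    (heven : κ.Even) (hord : ∃ j : ℕ, orderOf κ = p ^ j)
    {κ' : DirichletCharacter ℂ_[p] (p ^ (n + 1 + 1 + cyclotomicExponent p))} (hκ' : κ'.IsPrimitive)
    (heven' : κ'.Even) (hord' : ∃ j : ℕ, orderOf κ' = p ^ j) {t : ℕ}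
    (ht : t = 1 ∨ t = semistabilityIndex W p - 1)
    (hval : ‖ratTwistedSymbolSum f κ‖ ^ (semistabilityIndex W p * Nat.totient (p ^ (n + 1))) =
      ((p : ℝ)⁻¹) ^ (semistabilityIndex W p + t * Nat.totient (p ^ (n + 1))))
    (hval' : ‖ratTwistedSymbolSum f κ'‖ ^ (semistabilityIndex W p * Nat.totient (p ^ (n + 1 + 1))) =
      ((p : ℝ)⁻¹) ^ (semistabilityIndex W p + t * Nat.totient (p ^ (n + 1 + 1))))
    {Dh : PAdicHeightData W p} (hBcl : LeadingTermClauses W p Dh)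
    {K : ZpExtension ℚ p} {γ : Field.absoluteGaloisGroup ℚ}
    (hK : K.IsCyclotomic) (hγ : K.IsTopGenerator γ) (hcv : IsCyclotomicVariable p γ)
    (D : W.SelmerDualData K γ) [Module.Finite (IwasawaAlgebra p) D.X]
    {fE : IwasawaAlgebra p} (hchar : D.charIdeal = Ideal.span {fE}) :
    SchneiderConjecture Dh ∧ Finite (AddCommGroup.primaryComponent W.sha p) ∧
      X1.MuLambda.lam fE = 1 ∧
      ∃ ℓ : ℕ, ℓ ∣ p ^ 2 ∧ (ReductionNonAnomalous W p → ℓ = 1) ∧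
        (padicValNat p (Nat.card (AddCommGroup.primaryComponent W.sha p)) : ℤ) +
            (padicRegulator Dh).valuation + padicValNat p W.tamagawaProduct + padicValNat p ℓ =
          X1.MuLambda.mu fE + 1 + 2 * padicValNat p W.torsionOrder := by
  obtain ⟨u, χ, hu, hχe, hteich⟩ := exists_small_teichmullerPow_of_typeGOrd (W := W) h5 hX.typeGOrd
  exact ClassX4Gord.padicVal_identity_rankOne_of_thm1_of_two_norm_ratTwistedSymbolSum hD hC hDel hDelM hX
    h5 hcm he hrk hf hχe hu hteich hκ heven hord hκ' heven' hord' ht hval hval' hBcl hK hγ hcv D hchar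

end CharacterFree

/-! ### Rank zero: the sign READ from one value -/

section RankZeroSign

variable {W : WeierstrassCurve ℚ} [W.IsElliptic] [W.IsGloballyMinimal] {p : ℕ} [hp : Fact p.Prime]
  {N : ℕ} [NeZero N] {f : CuspForm (Gamma0 N) 2} {χ : MulChar (ZMod p) ℚ_[p]}

/-- **RANK ZERO — Delbourgo's `ε` READ from ONE value.** `p ≥ 5`, ADDITIVE, (G)-ordinary,
`e = semistabilityIndex W p ∈ {3,4,6}`, newform `f`, plus-symbol tower bound `p^c` ATTAINED AT `0`
(`‖[0]⁺_f‖_p = p^c`), `χ = ω^u` the Teichmüller power of the small exponent of order `e`, and ONE even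
primitive `p`-power-order `κ` of conductor `p^m ≥ p²` whose twisted symbol sum has the STARRED constant
value **`‖S(κ)‖^e = (p^c)^e·p^{−(e−1)}`** (`ord_p S = 1 − 1/e − c`). Then Delbourgo 1998 Thm 1's bounded
branch belongs to **`χ⁻¹ = ω^{(e−1)u}`**: there are `ã₀` (`‖ã₀‖ = 1`) and `B` with
`IsTameBranchOf f p (ι∘χ⁻¹) ã₀ B` and the tower bounds inherited (its constant term `ã₀⁻¹[0]⁺_f` is the
first top coefficient, so `χ₀ = χ` would force the UNSTARRED constant `(p^c)^e·p⁻¹ ≠ (p^c)^e·p^{−(e−1)}`).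
Gen 27's `norm_ratTwistedSymbolSum_pow_eq_or_of_thm1_of_norm_ratPlusSymbol_zero` left "which one" open;
this reads it. Nothing booked. [cite: Delbourgo1998, Theorem 1 (p. 131)] [cite: Lang1990, Ch. 1 §2 Thm. 2.1]
[cite: MazurTateTeitelbaum1986Invent, §I.8, §I.14 (14.3)] -/
theorem exists_isTameBranchOf_inv_of_thm1_of_norm_ratPlusSymbol_eq_of_norm_ratTwistedSymbolSum_pow_eq
    (hD : Delbourgo1998.thm1_exists_bounded_evenMeasure) (h5 : 5 ≤ p) (hadd : Addv W p)
    (hGord : TypeGOrd W p) (he : semistabilityIndex W p ∈ ({3, 4, 6} : Finset ℕ))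
    (hf : IsNewformOf W f) (hχe : orderOf χ = semistabilityIndex W p) {u : ℕ}
    (hu : semistabilityIndex W p * u = p - 1)
    (hteich : ∀ a : ZMod p, a ≠ 0 → ‖χ a - ((a.val : ℕ) : ℚ_[p]) ^ u‖ < 1) {c : ℕ}
    (hc : ∀ (m : ℕ) (a : ℤ), ‖((ratPlusSymbol f ((a : ℚ) / (p : ℚ) ^ m) : ℚ) : ℚ_[p])‖ ≤ (p : ℝ) ^ c)
    (h0 : ‖((ratPlusSymbol f 0 : ℚ) : ℚ_[p])‖ = (p : ℝ) ^ c)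
    {m : ℕ} (hm : 2 ≤ m) {κ : DirichletCharacter ℂ_[p] (p ^ m)} (hκ : κ.IsPrimitive) (heven : κ.Even)
    (hord : ∃ j : ℕ, orderOf κ = p ^ j)
    (hval : ‖ratTwistedSymbolSum f κ‖ ^ semistabilityIndex W p =
      ((p : ℝ) ^ c) ^ semistabilityIndex W p * ((p : ℝ)⁻¹) ^ (semistabilityIndex W p - 1)) :
    ∃ (ã₀ : ℚ_[p]) (B : PowerSeries ℚ_[p]), ‖ã₀‖ = 1 ∧
      IsTameBranchOf f p (χ⁻¹.ringHomComp (algebraMap ℚ_[p] ℂ_[p])) ã₀ B ∧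
      ∀ C : ℝ, (∀ (n : ℕ) (a : ℤ), ‖((ratPlusSymbol f ((a : ℚ) / (p : ℚ) ^ n) : ℚ) : ℚ_[p])‖ ≤ C) →
        ∀ j : ℕ, ‖PowerSeries.coeff j B‖ ≤ C := by
  have hp2 : p ≠ 2 := by omega
  have hp0 : (p : ℝ) ≠ 0 := Nat.cast_ne_zero.mpr hp.out.ne_zero
  have hp1 : (1 : ℝ) < p := by exact_mod_cast hp.out.one_lt
  set e := semistabilityIndex W p with he_def
  have h3 : 3 ≤ e := three_le_of_mem he
  have h2 : 2 ≤ e := by omega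
  have hG : SubGord W p := (subGord_iff_typeG_of_addv W p hp2 hadd).mpr hGord.typeG
  obtain ⟨χ₀, ã₀, B, hord0, hã₀, hB, hint⟩ := exists_isTameBranchOf_of_thm1 hD h5 hadd hGord he hf
  have hbd : ∀ j : ℕ, ‖PowerSeries.coeff j B‖ ≤ (p : ℝ) ^ c := hint _ hc
  have hk : ‖PowerSeries.coeff 0 B‖ = (p : ℝ) ^ c := by
    rw [PowerSeries.coeff_zero_eq_constantCoeff, hB.constantCoeff, norm_mul, norm_inv, hã₀, inv_one,
      one_mul, h0]
  have hord0' : orderOf χ₀ = e := by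
    have h := hord0
    rwa [orderOf_ringHomComp_padicComplex, tameDefect_of_not_potMult W p hG.1] at h
  rcases eq_or_eq_inv_of_orderOf_eq he hχe hord0' with hc0 | hc0
  · -- `χ₀ = ω^u` would give the unstarred constant `(p^c)^e · p⁻¹`
    exfalso
    subst hc0
    have hX := hB.mul_norm_tameGaussSum_mul_norm_eq_of_firstTop hã₀ hbd hk
      (fun i hi ↦ absurd hi (Nat.not_lt_zero i)) hm hκ heven hord
      (by rw [pow_zero]; exact inv_lt_one_of_one_lt₀ hp1)
    rw [pow_zero, mul_one] at hX
    have hτ := norm_tameGaussSum_pow_eq_of_teichmullerPow hteich hχe h2 hu hm hκ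
    have h1 := congrArg (· ^ e) hX
    simp only [mul_pow] at h1
    rw [hτ, pow_mul_inv_pow_sub_one (by omega), hval] at h1
    -- `p · (p^c)^e · p^{−(e−1)} = (p^c)^e` forces `p^{e−1} = p`, i.e. `e = 2`
    have hpc : ((p : ℝ) ^ c) ^ e ≠ 0 := pow_ne_zero _ (pow_ne_zero _ hp0)
    have h2' : (p : ℝ) * ((p : ℝ)⁻¹) ^ (e - 1) = 1 := by
      have h1' : ((p : ℝ) * ((p : ℝ)⁻¹) ^ (e - 1)) * ((p : ℝ) ^ c) ^ e = 1 * ((p : ℝ) ^ c) ^ e := by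
        rw [one_mul]; calc _ = (p : ℝ) * (((p : ℝ) ^ c) ^ e * ((p : ℝ)⁻¹) ^ (e - 1)) := by ring
          _ = ((p : ℝ) ^ c) ^ e := h1
      exact mul_right_cancel₀ hpc h1'
    have h3' : ((p : ℝ)⁻¹) ^ (e - 1) = ((p : ℝ)⁻¹) ^ 1 := by
      rw [pow_one]
      have : (p : ℝ) * ((p : ℝ)⁻¹) ^ (e - 1) = (p : ℝ) * (p : ℝ)⁻¹ := by rw [h2', mul_inv_cancel₀ hp0]
      exact mul_left_cancel₀ hp0 this
    have hinj := pow_right_injective₀ (inv_pos.mpr (by exact_mod_cast hp.out.pos))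
      (inv_ne_one.mpr (by exact_mod_cast hp.out.one_lt.ne')) h3'
    omega
  · subst hc0
    exact ⟨ã₀, B, hã₀, hB, hint⟩

/-- **RANK ZERO — the unstarred sign READ from one value**: same setting, ONE `κ` with the UNSTARRED
constant **`‖S(κ)‖^e = (p^c)^e·p⁻¹`** (`ord_p S = 1/e − c`) ⟹ the bounded branch belongs to
**`χ = ω^u`**: a witness of `(ι∘χ, ã₀)` with the tower bounds exists. (Gen 26's
`towerBounded_forced_of_thm1_of_norm_ratTwistedSymbolSum` said this in forced-partner currency with a
(G)-field and the unit root; here field-free.) Nothing booked. [cite: Delbourgo1998, Theorem 1 (p. 131)]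
[cite: Lang1990, Ch. 1 §2 Thm. 2.1] [cite: MazurTateTeitelbaum1986Invent, §I.8, §I.14 (14.3)] -/
theorem exists_isTameBranchOf_of_thm1_of_norm_ratPlusSymbol_eq_of_norm_ratTwistedSymbolSum_pow_eq
    (hD : Delbourgo1998.thm1_exists_bounded_evenMeasure) (h5 : 5 ≤ p) (hadd : Addv W p)
    (hGord : TypeGOrd W p) (he : semistabilityIndex W p ∈ ({3, 4, 6} : Finset ℕ))
    (hf : IsNewformOf W f) (hχe : orderOf χ = semistabilityIndex W p) {u : ℕ}
    (hu : semistabilityIndex W p * u = p - 1)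
    (hteich : ∀ a : ZMod p, a ≠ 0 → ‖χ a - ((a.val : ℕ) : ℚ_[p]) ^ u‖ < 1) {c : ℕ}
    (hc : ∀ (m : ℕ) (a : ℤ), ‖((ratPlusSymbol f ((a : ℚ) / (p : ℚ) ^ m) : ℚ) : ℚ_[p])‖ ≤ (p : ℝ) ^ c)
    (h0 : ‖((ratPlusSymbol f 0 : ℚ) : ℚ_[p])‖ = (p : ℝ) ^ c)
    {m : ℕ} (hm : 2 ≤ m) {κ : DirichletCharacter ℂ_[p] (p ^ m)} (hκ : κ.IsPrimitive) (heven : κ.Even)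
    (hord : ∃ j : ℕ, orderOf κ = p ^ j)
    (hval : ‖ratTwistedSymbolSum f κ‖ ^ semistabilityIndex W p =
      ((p : ℝ) ^ c) ^ semistabilityIndex W p * (p : ℝ)⁻¹) :
    ∃ (ã₀ : ℚ_[p]) (B : PowerSeries ℚ_[p]), ‖ã₀‖ = 1 ∧
      IsTameBranchOf f p (χ.ringHomComp (algebraMap ℚ_[p] ℂ_[p])) ã₀ B ∧
      ∀ C : ℝ, (∀ (n : ℕ) (a : ℤ), ‖((ratPlusSymbol f ((a : ℚ) / (p : ℚ) ^ n) : ℚ) : ℚ_[p])‖ ≤ C) →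
        ∀ j : ℕ, ‖PowerSeries.coeff j B‖ ≤ C := by
  have hp2 : p ≠ 2 := by omega
  have hp0 : (p : ℝ) ≠ 0 := Nat.cast_ne_zero.mpr hp.out.ne_zero
  have hp1 : (1 : ℝ) < p := by exact_mod_cast hp.out.one_lt
  set e := semistabilityIndex W p with he_def
  have h3 : 3 ≤ e := three_le_of_mem he
  have h2 : 2 ≤ e := by omega
  have hG : SubGord W p := (subGord_iff_typeG_of_addv W p hp2 hadd).mpr hGord.typeG
  obtain ⟨χ₀, ã₀, B, hord0, hã₀, hB, hint⟩ := exists_isTameBranchOf_of_thm1 hD h5 hadd hGord he hf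
  have hbd : ∀ j : ℕ, ‖PowerSeries.coeff j B‖ ≤ (p : ℝ) ^ c := hint _ hc
  have hk : ‖PowerSeries.coeff 0 B‖ = (p : ℝ) ^ c := by
    rw [PowerSeries.coeff_zero_eq_constantCoeff, hB.constantCoeff, norm_mul, norm_inv, hã₀, inv_one,
      one_mul, h0]
  have hord0' : orderOf χ₀ = e := by
    have h := hord0
    rwa [orderOf_ringHomComp_padicComplex, tameDefect_of_not_potMult W p hG.1] at h
  rcases eq_or_eq_inv_of_orderOf_eq he hχe hord0' with hc0 | hc0
  · subst hc0
    exact ⟨ã₀, B, hã₀, hB, hint⟩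
  · -- `χ₀ = ω^{−u}` would give the starred constant `(p^c)^e · p^{−(e−1)}`
    exfalso
    subst hc0
    have hX := hB.mul_norm_tameGaussSum_mul_norm_eq_of_firstTop hã₀ hbd hk
      (fun i hi ↦ absurd hi (Nat.not_lt_zero i)) hm hκ heven hord
      (by rw [pow_zero]; exact inv_lt_one_of_one_lt₀ hp1)
    rw [pow_zero, mul_one] at hX
    have hτ := norm_tameGaussSum_inv_pow_eq_of_teichmullerPow hteich hχe h2 hu hm hκ
    have h1 := congrArg (· ^ e) hX
    simp only [mul_pow] at h1
    rw [hτ, pow_mul_inv_eq_pow_sub_one (by omega), hval] at h1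
    -- `p^{e−1} · (p^c)^e · p⁻¹ = (p^c)^e` forces `p^{e−1} = p`
    have hpc : ((p : ℝ) ^ c) ^ e ≠ 0 := pow_ne_zero _ (pow_ne_zero _ hp0)
    have h2' : (p : ℝ) ^ (e - 1) * (p : ℝ)⁻¹ = 1 := by
      have h1' : ((p : ℝ) ^ (e - 1) * (p : ℝ)⁻¹) * ((p : ℝ) ^ c) ^ e = 1 * ((p : ℝ) ^ c) ^ e := by
        rw [one_mul]; calc _ = (p : ℝ) ^ (e - 1) * (((p : ℝ) ^ c) ^ e * (p : ℝ)⁻¹) := by ring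
          _ = ((p : ℝ) ^ c) ^ e := h1
      exact mul_right_cancel₀ hpc h1'
    have h3' : (p : ℝ) ^ (e - 1) = (p : ℝ) ^ 1 := by
      rw [pow_one]
      have : (p : ℝ) ^ (e - 1) * (p : ℝ)⁻¹ * p = 1 * p := by rw [h2']
      rwa [inv_mul_cancel_right₀ hp0, one_mul] at this
    have hinj := pow_right_injective₀ (by exact_mod_cast hp.out.pos) (by exact_mod_cast hp.out.one_lt.ne')
      h3'
    omega

end RankZeroSign

end TwistPartner

end Summit.BirchSwinnertonDyer.Rank1Residual.Additive

end
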